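import Mathlib
import Summits.ValiantsHypothesis.ValiantsHypothesis.Theorems.RigidityForcesSymmetryRankRigidMinimalReprLaplaceDefs
import Summits.ValiantsHypothesis.ValiantsHypothesis.Theorems.RigidityForcesSymmetryRankRigidMinimalReprLaplaceFourDefs
import Summits.ValiantsHypothesis.ValiantsHypothesis.Theorems.RigidityForcesSymmetryRankRigidMinimalReprLaplaceFourContraction
import Summits.ValiantsHypothesis.ValiantsHypothesis.Theorems.RigidityForcesSymmetryRankRigidMinimalReprLaplaceFourTyping
import Summits.ValiantsHypothesis.ValiantsHypothesis.Theorems.RigidityForcesSymmetryRankRigidMinimalReprLaplaceFourBlock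
import Summits.ValiantsHypothesis.ValiantsHypothesis.Theorems.RigidityForcesSymmetryRankRigidMinimalReprLaplaceFourS9

/-!
# The profile `(2,2,1)` of `LaplaceOptimal 4` is impossible (`profile_221`)
# (crux `RankRigidMinimalRepr`, stmt-ValiantsHypothesis-18034, route `RigidityForcesSymmetry`)

For a `(2,2,1)` decomposition in canonical position (`g_t ∈ span{E^{01}, A_{23}}`), the S9 lemma gives the column
pattern of `b_k, b′_k, c, c′` on the letters `{2,3}`.  Then:
* `h_shape`: typing the slot-swapped decomposition (`(02)(13)`, roles `g ↔ h`) and comparing with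
  `P(0,1,2,3) = P(0,1,3,2) = 1` forces `h_t ∈ span{A_{01}, E^{23}}`;
* `rows01_of_h_shape`: the S9 lemma for the slot-swapped, letter-relabelled (`(02)(13)`) decomposition gives the
  row pattern of `b_k, b′_k, c, c′` on the letters `{0,1}`.
`profile_221_canonical` then reads off four entries of `P₄` (`P(2,3,2,3) + P(3,2,3,2) = 0`, `P(0,3,2,1) = P(2,1,0,3) = 1`)
and `profile_221` removes the canonical position (BLOCK excluded by `block_false`).

HONEST FRAMING: a step toward `LaplaceOptimal 4` (rung `TiedTorusBound 3`); the crux stays OPEN; nothing on `VP ≠ VNP`.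
-/

set_option autoImplicit false

-- the mandated summit-side namespace repeats a component by design (single-problem summit)
set_option linter.dupNamespace false

namespace Summit.ValiantsHypothesis.ValiantsHypothesis.Theorems.RigidityForcesSymmetryRankRigidMinimalRepr

namespace LaplaceFourLine

open Matrix LaplaceFourContraction

/-! ### §1 Slot and letter symmetries of a `(2,2,1)` decomposition -/

/-- Four distinct letters exhaust `Fin 4`. -/
theorem all_of_nodup : ∀ a b c d : Fin 4, [a, b, c, d].Nodup → ∀ i : Fin 4, i = a ∨ i = b ∨ i = c ∨ i = d := by
  decide

/-- A letter relabelling with prescribed values. -/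
theorem exists_perm_of_nodup : ∀ a b c d : Fin 4, [a, b, c, d].Nodup →
    ∃ π : Equiv.Perm (Fin 4), π 0 = c ∧ π 1 = d ∧ π 2 = a ∧ π 3 = b := by
  decide

/-- The slot symmetry `(02)(13)`: swapping the roles of `g` and `h` (and transposing the other arrays). -/
theorem hsum221_swap (g h b b' : Fin 2 → Fin 4 → Fin 4 → ℂ) (c c' : Fin 4 → Fin 4 → ℂ)
    (hsum : ∀ v, permPattern₄ v = (∑ t, g t (v 0) (v 1) * h t (v 2) (v 3)) +
      (∑ k, b k (v 0) (v 2) * b' k (v 1) (v 3)) + c (v 0) (v 3) * c' (v 1) (v 2)) :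
    ∀ v, permPattern₄ v = (∑ t, h t (v 0) (v 1) * g t (v 2) (v 3)) +
      (∑ k, (fun x z => b k z x) (v 0) (v 2) * (fun y w => b' k w y) (v 1) (v 3)) +
      (fun x w => c' w x) (v 0) (v 3) * (fun y z => c z y) (v 1) (v 2) := by
  intro v
  have := congrFun (slotPerm_permPattern (Equiv.swap 0 2 * Equiv.swap 1 3)) v
  rw [← this]
  simp only [slotPerm]
  rw [hsum]
  simp [Equiv.swap_apply_of_ne_of_ne]
  ring

/-! ### §2 The shape of `ℋ` -/

/-- The combinatorial core: an EA labelling `(a',b' | c',d')` of `ℋ` compatible with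
`Σ_t β_t h_t(2,3) = Σ_t β_t h_t(3,2) = 1` has `{c',d'} = {2,3}` and `{a',b'} = {0,1}`. -/
theorem labelling_of_h (h : Fin 2 → Fin 4 → Fin 4 → ℂ) (β : Fin 2 → ℂ) (a' b'' c' d' : Fin 4)
    (hnd : [a', b'', c', d'].Nodup)
    (hEA : ∀ t, (h t a' a' = 0 ∧ h t b'' b'' = 0 ∧ h t a' b'' + h t b'' a' = 0 ∧
        ∀ j, j ≠ a' → j ≠ b'' → h t a' j = 0 ∧ h t b'' j = 0) ∧
      (h t c' c' = 0 ∧ h t d' d' = 0 ∧ h t c' d' = h t d' c' ∧ ∀ j, j ≠ c' → j ≠ d' → h t c' j = 0 ∧ h t d' j = 0))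
    (E1 : (∑ t, β t * h t 2 3) = 1) (E2 : (∑ t, β t * h t 3 2) = 1) :
    ((a' = 0 ∧ b'' = 1) ∨ (a' = 1 ∧ b'' = 0)) ∧ ((c' = 2 ∧ d' = 3) ∨ (c' = 3 ∧ d' = 2)) := by
  have hall := all_of_nodup a' b'' c' d' hnd
  have h' := hnd
  simp only [List.nodup_cons, List.mem_cons, not_or, List.not_mem_nil, List.nodup_nil, not_false_eq_true,
    and_true] at h'
  obtain ⟨⟨hab, -, -⟩, -, -⟩ := h'
  have no_anti : ¬ (∀ t, h t 2 3 + h t 3 2 = 0) := by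
    intro H
    have : (∑ t, β t * h t 2 3) + (∑ t, β t * h t 3 2) = 0 := by
      rw [← Finset.sum_add_distrib]
      exact Finset.sum_eq_zero fun t _ => by rw [← mul_add, H t, mul_zero]
    rw [E1, E2] at this; norm_num at this
  have no_zero : ¬ (∀ t, h t 2 3 = 0) := by
    intro H; rw [Finset.sum_eq_zero fun t _ => by rw [H t, mul_zero]] at E1; exact zero_ne_one E1
  have key : (c' = 2 ∧ d' = 3) ∨ (c' = 3 ∧ d' = 2) := by
    rcases hall 2 with h2 | h2 | h2 | h2
    · exfalso
      by_cases h3 : (3 : Fin 4) = b''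
      · exact no_anti fun t => by rw [h2, h3]; exact (hEA t).1.2.2.1
      · exact no_zero fun t => by rw [h2]; exact ((hEA t).1.2.2.2 3 (by rw [← h2]; decide) h3).1
    · exfalso
      by_cases h3 : (3 : Fin 4) = a'
      · exact no_anti fun t => by rw [h2, h3, add_comm]; exact (hEA t).1.2.2.1
      · exact no_zero fun t => by rw [h2]; exact ((hEA t).1.2.2.2 3 h3 (by rw [← h2]; decide)).2
    · by_cases h3 : (3 : Fin 4) = d'
      · exact Or.inl ⟨h2.symm, h3.symm⟩
      · exact (no_zero fun t => by rw [h2]; exact ((hEA t).2.2.2.2 3 (by rw [← h2]; decide) h3).1).elim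
    · by_cases h3 : (3 : Fin 4) = c'
      · exact Or.inr ⟨h3.symm, h2.symm⟩
      · exact (no_zero fun t => by rw [h2]; exact ((hEA t).2.2.2.2 3 h3 (by rw [← h2]; decide)).2).elim
  refine ⟨?_, key⟩
  have hc' : c' = 2 ∨ c' = 3 := by rcases key with ⟨h1, -⟩ | ⟨h1, -⟩ <;> simp [h1]
  have hd' : d' = 2 ∨ d' = 3 := by rcases key with ⟨-, h1⟩ | ⟨-, h1⟩ <;> simp [h1]
  have h0 : (0 : Fin 4) = a' ∨ (0 : Fin 4) = b'' := by
    rcases hall 0 with h0 | h0 | h0 | h0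
    · exact Or.inl h0
    · exact Or.inr h0
    · exfalso; rcases hc' with h1 | h1 <;> rw [h1] at h0 <;> exact absurd h0 (by decide)
    · exfalso; rcases hd' with h1 | h1 <;> rw [h1] at h0 <;> exact absurd h0 (by decide)
  have h1 : (1 : Fin 4) = a' ∨ (1 : Fin 4) = b'' := by
    rcases hall 1 with h1 | h1 | h1 | h1
    · exact Or.inl h1
    · exact Or.inr h1
    · exfalso; rcases hc' with h2 | h2 <;> rw [h2] at h1 <;> exact absurd h1 (by decide)
    · exfalso; rcases hd' with h2 | h2 <;> rw [h2] at h1 <;> exact absurd h1 (by decide)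
  rcases h0 with h0 | h0 <;> rcases h1 with h1 | h1
  · exact absurd (h0.trans h1.symm) (by decide)
  · exact Or.inl ⟨h0.symm, h1.symm⟩
  · exact Or.inr ⟨h1.symm, h0.symm⟩
  · exact absurd (h0.trans h1.symm) (by decide)

/-- In canonical position, `h_t ∈ span{A_{01}, E^{23}}`. -/
theorem h_shape (g h b b' : Fin 2 → Fin 4 → Fin 4 → ℂ) (c c' : Fin 4 → Fin 4 → ℂ)
    (hsum : ∀ v, permPattern₄ v = (∑ t, g t (v 0) (v 1) * h t (v 2) (v 3)) +
      (∑ k, b k (v 0) (v 2) * b' k (v 1) (v 3)) + c (v 0) (v 3) * c' (v 1) (v 2))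
    (hg : ∀ t, (g t 2 2 = 0 ∧ g t 3 3 = 0 ∧ g t 2 3 + g t 3 2 = 0 ∧ ∀ j, j ≠ 2 → j ≠ 3 → g t 2 j = 0 ∧ g t 3 j = 0) ∧
      (g t 0 0 = 0 ∧ g t 1 1 = 0 ∧ g t 0 1 = g t 1 0 ∧ ∀ j, j ≠ 0 → j ≠ 1 → g t 0 j = 0 ∧ g t 1 j = 0)) :
    ∀ t, (h t 0 0 = 0 ∧ h t 1 1 = 0 ∧ h t 0 1 + h t 1 0 = 0 ∧ ∀ j, j ≠ 0 → j ≠ 1 → h t 0 j = 0 ∧ h t 1 j = 0) ∧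
      (h t 2 2 = 0 ∧ h t 3 3 = 0 ∧ h t 2 3 = h t 3 2 ∧ ∀ j, j ≠ 2 → j ≠ 3 → h t 2 j = 0 ∧ h t 3 j = 0) := by
  obtain ⟨hb, -, hc, -⟩ := columns23_of_EA g h b b' c c' hsum hg
  -- `Σ_t g_t(0,1) h_t(2,3) = 1 = Σ_t g_t(0,1) h_t(3,2)`
  have E1 : (∑ t, g t 0 1 * h t 2 3) = 1 := by
    have := hsum ![0, 1, 2, 3]
    simp only [permPattern₄, injective_vec4_iff] at this
    rw [if_pos (by decide)] at this
    simp only [Fin.isValue, Matrix.cons_val_zero, Matrix.cons_val_one, Matrix.head_cons, Matrix.cons_val_two,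
      Matrix.tail_cons, Matrix.cons_val_three, Fin.sum_univ_two, (hb 0).1, (hb 1).1, hc.2.2.2.1] at this
    rw [Fin.sum_univ_two]; linear_combination -this
  have E2 : (∑ t, g t 0 1 * h t 3 2) = 1 := by
    have := hsum ![0, 1, 3, 2]
    simp only [permPattern₄, injective_vec4_iff] at this
    rw [if_pos (by decide)] at this
    simp only [Fin.isValue, Matrix.cons_val_zero, Matrix.cons_val_one, Matrix.head_cons, Matrix.cons_val_two,
      Matrix.tail_cons, Matrix.cons_val_three, Fin.sum_univ_two, (hb 0).2.2.2.1, (hb 1).2.2.2.1, hc.1] at this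
    rw [Fin.sum_univ_two]; linear_combination -this
  -- typing of `ℋ` via the slot swap
  have hsum' := hsum221_swap g h b b' c c' hsum
  rcases typing_G h g (fun k x z => b k z x) (fun k y w => b' k w y) (fun x w => c' w x) (fun y z => c z y) hsum'
    with ⟨c₀, d₀, hcd, hrows⟩ | ⟨a', b'', c', d', hnd, hEA⟩
  · exact (block_false h g (fun k x z => b k z x) (fun k y w => b' k w y) (fun x w => c' w x) (fun y z => c z y)
      hsum' c₀ d₀ hcd hrows).elim
  obtain ⟨key', key⟩ := labelling_of_h h (fun t => g t 0 1) a' b'' c' d' hnd hEA E1 E2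
  intro t
  obtain ⟨⟨haa, hbb, habs, hrab⟩, ⟨hcc, hdd, hcds, hrcd⟩⟩ := hEA t
  rcases key' with ⟨rfl, rfl⟩ | ⟨rfl, rfl⟩ <;> rcases key with ⟨rfl, rfl⟩ | ⟨rfl, rfl⟩
  · exact ⟨⟨haa, hbb, habs, hrab⟩, ⟨hcc, hdd, hcds, hrcd⟩⟩
  · exact ⟨⟨haa, hbb, habs, hrab⟩, ⟨hdd, hcc, hcds.symm, fun j h2 h3 => ⟨(hrcd j h3 h2).2, (hrcd j h3 h2).1⟩⟩⟩
  · exact ⟨⟨hbb, haa, by linear_combination habs, fun j h0 h1 => ⟨(hrab j h1 h0).2, (hrab j h1 h0).1⟩⟩,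
      ⟨hcc, hdd, hcds, hrcd⟩⟩
  · exact ⟨⟨hbb, haa, by linear_combination habs, fun j h0 h1 => ⟨(hrab j h1 h0).2, (hrab j h1 h0).1⟩⟩,
      ⟨hdd, hcc, hcds.symm, fun j h2 h3 => ⟨(hrcd j h3 h2).2, (hrcd j h3 h2).1⟩⟩⟩

/-! ### §3 The row pattern -/

/-- In canonical position (with `h_t ∈ span{A_{01}, E^{23}}`): rows `0, 1` of `b_k, b′_k, c, c′` vanish except for
equal entries at `(0,1), (1,0)`. -/
theorem rows01_of_h_shape (g h b b' : Fin 2 → Fin 4 → Fin 4 → ℂ) (c c' : Fin 4 → Fin 4 → ℂ)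
    (hsum : ∀ v, permPattern₄ v = (∑ t, g t (v 0) (v 1) * h t (v 2) (v 3)) +
      (∑ k, b k (v 0) (v 2) * b' k (v 1) (v 3)) + c (v 0) (v 3) * c' (v 1) (v 2))
    (hh : ∀ t, (h t 0 0 = 0 ∧ h t 1 1 = 0 ∧ h t 0 1 + h t 1 0 = 0 ∧ ∀ j, j ≠ 0 → j ≠ 1 → h t 0 j = 0 ∧ h t 1 j = 0) ∧
      (h t 2 2 = 0 ∧ h t 3 3 = 0 ∧ h t 2 3 = h t 3 2 ∧ ∀ j, j ≠ 2 → j ≠ 3 → h t 2 j = 0 ∧ h t 3 j = 0)) :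
    (∀ k, b k 0 0 = 0 ∧ b k 0 2 = 0 ∧ b k 0 3 = 0 ∧ b k 1 1 = 0 ∧ b k 1 2 = 0 ∧ b k 1 3 = 0 ∧ b k 0 1 = b k 1 0) ∧
    (∀ k, b' k 0 0 = 0 ∧ b' k 0 2 = 0 ∧ b' k 0 3 = 0 ∧ b' k 1 1 = 0 ∧ b' k 1 2 = 0 ∧ b' k 1 3 = 0 ∧
      b' k 0 1 = b' k 1 0) ∧
    (c 0 0 = 0 ∧ c 0 2 = 0 ∧ c 0 3 = 0 ∧ c 1 1 = 0 ∧ c 1 2 = 0 ∧ c 1 3 = 0 ∧ c 0 1 = c 1 0) ∧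
    (c' 0 0 = 0 ∧ c' 0 2 = 0 ∧ c' 0 3 = 0 ∧ c' 1 1 = 0 ∧ c' 1 2 = 0 ∧ c' 1 3 = 0 ∧ c' 0 1 = c' 1 0) := by
  let π : Equiv.Perm (Fin 4) := Equiv.swap 0 2 * Equiv.swap 1 3
  have hπ0 : π 0 = 2 := by decide
  have hπ1 : π 1 = 3 := by decide
  have hπ2 : π 2 = 0 := by decide
  have hπ3 : π 3 = 1 := by decide
  have hs := hsum221_letterPerm h g (fun k x z => b k z x) (fun k y w => b' k w y) (fun x w => c' w x)
    (fun y z => c z y) (hsum221_swap g h b b' c c' hsum) π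
  have hg' : ∀ t, ((fun t x y => h t (π x) (π y)) t 2 2 = 0 ∧ (fun t x y => h t (π x) (π y)) t 3 3 = 0 ∧
      (fun t x y => h t (π x) (π y)) t 2 3 + (fun t x y => h t (π x) (π y)) t 3 2 = 0 ∧
      ∀ j, j ≠ 2 → j ≠ 3 → (fun t x y => h t (π x) (π y)) t 2 j = 0 ∧ (fun t x y => h t (π x) (π y)) t 3 j = 0) ∧
      ((fun t x y => h t (π x) (π y)) t 0 0 = 0 ∧ (fun t x y => h t (π x) (π y)) t 1 1 = 0 ∧
      (fun t x y => h t (π x) (π y)) t 0 1 = (fun t x y => h t (π x) (π y)) t 1 0 ∧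
      ∀ j, j ≠ 0 → j ≠ 1 → (fun t x y => h t (π x) (π y)) t 0 j = 0 ∧ (fun t x y => h t (π x) (π y)) t 1 j = 0) := by
    intro t
    obtain ⟨⟨h00, h11, h01s, hr01⟩, ⟨h22, h33, h23s, hr23⟩⟩ := hh t
    simp only [hπ0, hπ1, hπ2, hπ3]
    refine ⟨⟨h00, h11, h01s, fun j hj2 hj3 => ?_⟩, ⟨h22, h33, h23s, fun j hj0 hj1 => ?_⟩⟩
    · fin_cases j <;> simp at hj2 hj3 <;>
        [exact hr01 2 (by decide) (by decide); exact hr01 3 (by decide) (by decide)]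
    · fin_cases j <;> simp at hj0 hj1 <;>
        [exact hr23 0 (by decide) (by decide); exact hr23 1 (by decide) (by decide)]
  obtain ⟨hB, hB', hC, hC'⟩ := columns23_of_EA (fun t x y => h t (π x) (π y)) (fun t z w => g t (π z) (π w))
    (fun k x z => b k (π z) (π x)) (fun k y w => b' k (π w) (π y)) (fun x w => c' (π w) (π x))
    (fun y z => c (π z) (π y)) hs hg'
  simp only [hπ0, hπ1, hπ2, hπ3] at hB hB' hC hC'
  refine ⟨fun k => ?_, fun k => ?_, ?_, ?_⟩
  · obtain ⟨e1, e2, e3, e4, e5, e6, e7⟩ := hB k; exact ⟨e3, e1, e2, e6, e4, e5, e7⟩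
  · obtain ⟨e1, e2, e3, e4, e5, e6, e7⟩ := hB' k; exact ⟨e3, e1, e2, e6, e4, e5, e7⟩
  · obtain ⟨e1, e2, e3, e4, e5, e6, e7⟩ := hC'; exact ⟨e3, e1, e2, e6, e4, e5, e7⟩
  · obtain ⟨e1, e2, e3, e4, e5, e6, e7⟩ := hC; exact ⟨e3, e1, e2, e6, e4, e5, e7⟩

/-! ### §4 The profile `(2,2,1)` and `LaplaceOptimal 4` -/

/-- The profile `(2,2,1)` in canonical position (`g_t ∈ span{E^{01}, A_{23}}`) is impossible. -/
theorem profile_221_canonical (g h b b' : Fin 2 → Fin 4 → Fin 4 → ℂ) (c c' : Fin 4 → Fin 4 → ℂ)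
    (hsum : ∀ v, permPattern₄ v = (∑ t, g t (v 0) (v 1) * h t (v 2) (v 3)) +
      (∑ k, b k (v 0) (v 2) * b' k (v 1) (v 3)) + c (v 0) (v 3) * c' (v 1) (v 2))
    (hg : ∀ t, (g t 2 2 = 0 ∧ g t 3 3 = 0 ∧ g t 2 3 + g t 3 2 = 0 ∧ ∀ j, j ≠ 2 → j ≠ 3 → g t 2 j = 0 ∧ g t 3 j = 0) ∧
      (g t 0 0 = 0 ∧ g t 1 1 = 0 ∧ g t 0 1 = g t 1 0 ∧ ∀ j, j ≠ 0 → j ≠ 1 → g t 0 j = 0 ∧ g t 1 j = 0)) :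
    False := by
  obtain ⟨hb, hb', hc, hc'⟩ := columns23_of_EA g h b b' c c' hsum hg
  have hh := h_shape g h b b' c c' hsum hg
  obtain ⟨rb, rb', rc, rc'⟩ := rows01_of_h_shape g h b b' c c' hsum hh
  -- g facts
  have g03 : ∀ t, g t 0 3 = 0 := fun t => ((hg t).2.2.2.2 3 (by decide) (by decide)).1
  have g21 : ∀ t, g t 2 1 = 0 := fun t => ((hg t).1.2.2.2 1 (by decide) (by decide)).1
  have g32 : ∀ t, g t 3 2 = -g t 2 3 := fun t => by linear_combination (hg t).1.2.2.1
  have h32 : ∀ t, h t 3 2 = h t 2 3 := fun t => (hh t).2.2.2.1.symm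
  -- four entries of `P₄`
  have E4 := hsum ![2, 3, 2, 3]
  have E5 := hsum ![3, 2, 3, 2]
  have E9 := hsum ![0, 3, 2, 1]
  have E10 := hsum ![2, 1, 0, 3]
  simp only [permPattern₄, injective_vec4_iff] at E4 E5 E9 E10
  rw [if_neg (by decide)] at E4 E5
  rw [if_pos (by decide)] at E9 E10
  simp only [Fin.isValue, Matrix.cons_val_zero, Matrix.cons_val_one, Matrix.head_cons, Matrix.cons_val_two,
    Matrix.tail_cons, Matrix.cons_val_three, Fin.sum_univ_two, (hb 0).2.2.1, (hb 1).2.2.1, (hb 0).2.2.2.2.2.1,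
    (hb 1).2.2.2.2.2.1, g03, g21, g32, h32, (rb 0).2.1, (rb 1).2.1, (rb' 0).2.2.2.2.2.1, (rb' 1).2.2.2.2.2.1,
    hc.2.2.2.2.2.2, hc'.2.2.2.2.2.2] at E4 E5 E9 E10
  have hτ : c 2 3 * c' 2 3 = 0 := by linear_combination (-(E4) - E5) / 2
  rcases mul_eq_zero.1 hτ with h0 | h0
  · rw [h0] at E10; norm_num at E10
  · rw [h0] at E9; norm_num at E9

/-- **The profile `(2,2,1)` is impossible**: `P₄` is not a sum of two pair terms on `01|23`, two on `02|13` and one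
on `03|12`.  (Typing of `𝒢`: BLOCK is excluded by `block_false`; EA is brought to canonical position by a letter
relabelling and excluded by `profile_221_canonical`.) -/
theorem profile_221 (g h b b' : Fin 2 → Fin 4 → Fin 4 → ℂ) (c c' : Fin 4 → Fin 4 → ℂ)
    (hsum : ∀ v, permPattern₄ v = (∑ t, g t (v 0) (v 1) * h t (v 2) (v 3)) +
      (∑ k, b k (v 0) (v 2) * b' k (v 1) (v 3)) + c (v 0) (v 3) * c' (v 1) (v 2)) : False := by
  rcases typing_G g h b b' c c' hsum with ⟨c₀, d₀, hcd, hrows⟩ | ⟨a₀, b₀, c₀, d₀, hnd, hEA⟩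
  · exact block_false g h b b' c c' hsum c₀ d₀ hcd hrows
  obtain ⟨π, hπ0, hπ1, hπ2, hπ3⟩ := exists_perm_of_nodup a₀ b₀ c₀ d₀ hnd
  refine profile_221_canonical (fun t x y => g t (π x) (π y)) (fun t z w => h t (π z) (π w))
    (fun k x z => b k (π x) (π z)) (fun k y w => b' k (π y) (π w)) (fun x w => c (π x) (π w))
    (fun y z => c' (π y) (π z)) (hsum221_letterPerm g h b b' c c' hsum π) (fun t => ?_)
  obtain ⟨⟨haa, hbb, habs, hrab⟩, ⟨hcc, hdd, hcds, hrcd⟩⟩ := hEA t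
  simp only [hπ0, hπ1, hπ2, hπ3]
  refine ⟨⟨haa, hbb, habs, fun j hj2 hj3 => hrab (π j) ?_ ?_⟩, ⟨hcc, hdd, hcds, fun j hj0 hj1 => hrcd (π j) ?_ ?_⟩⟩
  · exact fun e => hj2 (π.injective (e.trans hπ2.symm))
  · exact fun e => hj3 (π.injective (e.trans hπ3.symm))
  · exact fun e => hj0 (π.injective (e.trans hπ0.symm))
  · exact fun e => hj1 (π.injective (e.trans hπ1.symm))

end LaplaceFourLine

end Summit.ValiantsHypothesis.ValiantsHypothesis.Theorems.RigidityForcesSymmetryRankRigidMinimalRepr
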